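import Literature.RepresentationTheory.Semisimple.CommutingOperatorsSimpleModule
import Literature.Algebra.Lie.LefschetzModule
import HarnessLib

/-!
# Looijenga–Lunts (1.2) Lemma, tensor clause: an irreducible module of `𝔤 = 𝔤' × 𝔤'' ⊆ 𝔤𝔩(M)` is `M' ⊗ M''`

Topic `Literature/Algebra/Lie` (namespace `Literature.Algebra.Lie`).  Lane `lit-hodgefound` (Track 2 foundations
library), skeleton seat `lit-hodgefound-skel-1` (generation 44), row **A1-135** of
`run/shared/lean/pub/lit-hodgefound/SKELETON.md`; sequel of A1-112 `LefschetzTripleIdeals.lean` (the GRADED first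
clause of the (1.2) Lemma) supplying the TENSOR clause "`M ≅ M' ⊗ M''`" — the step "Since `M` is an irreducible
module of the semisimple Lie algebra `𝔤(𝔞, M)` [`= 𝔤' × 𝔤''`], it must have the form `M' ⊗ M''` with `M^{(i)}` a
`𝔤^{(i)}`-module" — from Bump's Prop. 3.4.1 / 3.4.2 in the operator form
(`Literature/RepresentationTheory/Semisimple/CommutingOperatorsSimpleModule.lean`, A1-134, over
`CommutingAlgebrasSimpleModule.lean`, A1-133).  For ANY Lie algebra of operators `𝔤 ⊆ 𝔤𝔩(M)` with complementary
ideals `I = 𝔤'`, `J = 𝔤''`, `M ≠ 0` finite-dimensional and irreducible over `𝔤` (Mathlib `LieModule.IsIrreducible`),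
over an ALGEBRAICALLY CLOSED field (needed: over `ℝ` the statement fails); specialised to `𝔤 = 𝔤(𝔞, M)` (A1-88
`lefschetzLieAlgebra`).  THEOREMS ONLY; no definition, no named fact, no `sorry`, no instance, no notation
(D-0026 net debt `0`); `LieRing.ofAssociativeRing` on `𝔤𝔩(M)` is enabled FILE-LOCALLY as in every parent.

## Source, VERBATIM

E. Looijenga, V. A. Lunts, *A Lie algebra attached to a projective variety*, Invent. Math. **129** (1997) 361–412,
§1 (1.2) (held TeX text `paper:arxiv-alg-geom_9604014`, p0004 L94–L105; the proof's continuation from the PDF text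
`paper:arxiv-alg-geom-9604014`, p0007 L1):

> "Lemma. Let `M` be an irreducible Lefschetz `𝔞`-module and let `𝔤(𝔞, M) = 𝔤' × 𝔤''` be a decomposition of
> Lie algebra's. Then this decomposition is graded and there exist irreducible Lefschetz `𝔞`-modules `M'` and
> `M''` such that `M ≅ M' ⊗ M''` as Lefschetz `𝔞`-modules with `𝔤'` resp. `𝔤''` corresponding to `𝔤(𝔞, M')`
> resp. `𝔤(𝔞, M'')`.
> Proof. Since the grading of `𝔤` is the eigen space decomposition of `ad_h` it is immediate that upon writing
> `h = (h', h'') ∈ 𝔤' × 𝔤''`, `𝔤^{(i)}` gets a grading from `ad_{h^{(i)}}` making the decomposition a graded one.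
> Since `M` is an irreducible module of the semisimple Lie algebra `𝔤(𝔞, M)`, it must have the form `M' ⊗ M''`
> with `M^{(i)}` a `𝔤^{(i)}`-module. This is compatible with the gradings. If the rational map
> `f : 𝔞 → 𝔤_{-2} = 𝔤'_{-2} ⊕ 𝔤''_{-2}` is written `(f', f'')`, then `[h, f] = -2f` implies `[h', f'] = -2f'` and
> `[h'', f''] = -2f''`. So `M^{(i)}` [is] a Lefschetz module of `𝔞` with the stated property."

## Rendering (dictionary)

* "`𝔤(𝔞, M) = 𝔤' × 𝔤''` a decomposition of Lie algebra's" = complementary ideals `I J : LieIdeal K 𝔤`,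
  `hIJ : IsCompl I J`, of `𝔤 : LieSubalgebra K (Module.End K M)` (as in A1-112); they commute elementwise as
  operators (`commute_of_mem_lieIdeal_of_inf_eq_bot`).
* "`M` irreducible" = `[LieModule.IsIrreducible K 𝔤 M]` (with `M ≠ 0`; = "every `𝔤`-stable subspace is `0` or
  `M`", `isIrreducible_iff_forall_stable_of_lieSubalgebra`).
* "`M ≅ M' ⊗ M''` with `M^{(i)}` a `𝔤^{(i)}`-module": `M' : Submodule K M`, `I`-stable and `I`-irreducible;
  `M'' = N : Submodule K (M' →ₗ[K] M)`, the maps commuting with `I` (`= Hom_{𝔤'}(M', M)`), on which `J = 𝔤''` acts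
  by composition, irreducibly; `e : M' ⊗[K] N ≃ₗ[K] M`, `e (m ⊗ φ) = φ m` — so `x ∈ 𝔤'` acts as `x|M' ⊗ 1` and
  `y ∈ 𝔤''` as `1 ⊗ (y ∘ ·)`; `dim M = dim M' · dim M''`.

## Contents (all proved)

* §1 `isIrreducible_iff_forall_stable_of_lieSubalgebra`, `commute_of_mem_lieIdeal_of_inf_eq_bot`,
  `stable_of_stable_lieIdeal_of_sup_eq_top`.
* §2 **`exists_tensor_of_isCompl_lieIdeal`** (any `𝔤 ⊆ 𝔤𝔩(M)`) and
  **`exists_tensor_of_isCompl_lieIdeal_lefschetzLieAlgebra`** (`𝔤 = 𝔤(𝔞, M)`).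

## SCOPE

(a) NOT formalised: the Lefschetz `𝔞`-module structures on `M'`, `M''` ("irreducible Lefschetz `𝔞`-modules"), the
compatibility with the gradings, and "`𝔤'` resp. `𝔤''` corresponding to `𝔤(𝔞, M')` resp. `𝔤(𝔞, M'')`" (the last
needs the generation of `𝔤(𝔞, M')` by the components `e'_a, f'_a`, a Zariski-density argument on the Lefschetz
loci).  (b) Semisimplicity of `𝔤` is not used for the tensor clause.  (c) `K` algebraically closed is assumed
(the printed statement is over a field `K` of characteristic `0`; over `K = ℝ` the clause fails, e.g. `𝔤' = ℂ`
acting on `M = ℂ`).  (d) Nothing here concerns complex tori or the Hodge conjecture.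

## References

* [LooijengaLunts1997] E. Looijenga, V. A. Lunts, *A Lie algebra attached to a projective variety*, Invent. Math.
  129 (1997) 361–412; arXiv:alg-geom/9604014. §1 (1.2) Lemma and proof, p. 4 L94–L105 of the held TeX text
  (continued: PDF text p. 7 L1).
* [Bump1997] D. Bump, *Automorphic Forms and Representations* (1997), §3.4 Prop. 3.4.1 / 3.4.2, PDF pp. 302–303
  — via `CommutingOperatorsSimpleModule.lean` / `CommutingAlgebrasSimpleModule.lean`.
-/

namespace Literature.Algebra.Lie

open Module Function Set
open scoped TensorProduct

-- The commutator Lie ring of `𝔤𝔩(M) = Module.End K M`: Mathlib's reducible NON-instance, enabled file-locally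
-- exactly as in `LefschetzModule.lean`.
attribute [local instance 100] LieRing.ofAssociativeRing

variable {K : Type*} [Field K] {M : Type*} [AddCommGroup M] [Module K M]

/-! ### §1 Irreducibility over a Lie algebra of operators; complementary ideals commute -/

/-- Irreducibility of `M` over a Lie algebra of operators `𝔤 ⊆ 𝔤𝔩(M)` in Mathlib's sense
(`LieModule.IsIrreducible`) is the elementary one: every `𝔤`-stable subspace is `0` or `M` (`M ≠ 0`).
(The case `𝔤 = 𝔤(𝔞, M)` is `isIrreducible_iff_forall_stable` in `LefschetzModulePrimitive.lean`.)
[cite: LooijengaLunts1997, §1 (1.2) Lemma p0004 L94–L99 ("Let M be an irreducible Lefschetz 𝔞-module")] -/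
theorem isIrreducible_iff_forall_stable_of_lieSubalgebra (𝔤 : LieSubalgebra K (Module.End K M)) [Nontrivial M] :
    LieModule.IsIrreducible K 𝔤 M ↔
      ∀ V : Submodule K M, (∀ x ∈ 𝔤, ∀ v ∈ V, x v ∈ V) → V = ⊥ ∨ V = ⊤ := by
  constructor
  · intro hI V hV
    let N : LieSubmodule K 𝔤 M :=
      { V with
        lie_mem := fun {x m} hm ↦ by
          rw [LieSubalgebra.coe_bracket_of_module, Module.End.lie_apply]
          exact hV x.1 x.2 m hm }
    rcases hI.eq_bot_or_eq_top N with h1 | h1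
    · exact Or.inl ((LieSubmodule.toSubmodule_eq_bot N).2 h1)
    · exact Or.inr ((LieSubmodule.toSubmodule_eq_top N).2 h1)
  · intro hV
    refine LieModule.IsIrreducible.mk fun N hN ↦ ?_
    rcases hV N.toSubmodule (fun x hx v hv ↦ by
      have := N.lie_mem (x := ⟨x, hx⟩) hv
      rwa [LieSubalgebra.coe_bracket_of_module, Module.End.lie_apply] at this) with h1 | h1
    · exact absurd ((LieSubmodule.toSubmodule_eq_bot N).1 h1) hN
    · exact (LieSubmodule.toSubmodule_eq_top N).1 h1

/-- **Two ideals `I`, `J` of a Lie algebra of operators with `I ∩ J = 0` commute elementwise as operators**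
(`[x, y] ∈ I ∩ J = 0`, and the bracket of `𝔤𝔩(M)` is the commutator).
[cite: LooijengaLunts1997, §1 (1.2) Lemma p0004 L94–L99 ("𝔤(𝔞, M) = 𝔤' × 𝔤'' a decomposition of Lie algebra's")] -/
theorem commute_of_mem_lieIdeal_of_inf_eq_bot {𝔤 : LieSubalgebra K (Module.End K M)} {I J : LieIdeal K 𝔤}
    (hIJ : I ⊓ J = ⊥) {x y : 𝔤} (hx : x ∈ I) (hy : y ∈ J) :
    Commute (x : Module.End K M) (y : Module.End K M) := by
  have h1 : ⁅x, y⁆ ∈ I ⊓ J := (LieSubmodule.mem_inf _ _ _).2 ⟨lie_mem_left K 𝔤 I x y hx, lie_mem_right K 𝔤 J x y hy⟩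
  rw [hIJ, LieSubmodule.mem_bot] at h1
  have h2 : ⁅(x : Module.End K M), (y : Module.End K M)⁆ = 0 := by
    rw [← LieSubalgebra.coe_bracket, h1]; rfl
  rw [Ring.lie_def, sub_eq_zero] at h2
  exact h2

/-- A subspace stable under two ideals `I`, `J` with `I + J = 𝔤` is stable under `𝔤`.
[cite: LooijengaLunts1997, §1 (1.2) Lemma p0004 L94–L99] -/
theorem stable_of_stable_lieIdeal_of_sup_eq_top {𝔤 : LieSubalgebra K (Module.End K M)} {I J : LieIdeal K 𝔤}
    (hIJ : I ⊔ J = ⊤) {V : Submodule K M} (hI : ∀ x ∈ I, ∀ v ∈ V, (x : Module.End K M) v ∈ V)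
    (hJ : ∀ y ∈ J, ∀ v ∈ V, (y : Module.End K M) v ∈ V) (x : 𝔤) {v : M} (hv : v ∈ V) :
    (x : Module.End K M) v ∈ V := by
  have hx : x ∈ I ⊔ J := by rw [hIJ]; exact LieSubmodule.mem_top x
  obtain ⟨i, hi, j, hj, rfl⟩ := (LieSubmodule.mem_sup _ _ _).1 hx
  exact V.add_mem (hI i hi v hv) (hJ j hj v hv)

/-! ### §2 The tensor clause of the (1.2) Lemma -/

/-- **Looijenga–Lunts (1.2) Lemma, proof: "Since `M` is an irreducible module of the semisimple Lie algebra
`𝔤(𝔞, M)` [`= 𝔤' × 𝔤''`], it must have the form `M' ⊗ M''` with `M^{(i)}` a `𝔤^{(i)}`-module."** — for ANY Lie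
algebra of operators `𝔤 ⊆ 𝔤𝔩(M)` with complementary ideals `I = 𝔤'`, `J = 𝔤''` (`I ⊕ J = 𝔤`), `M ≠ 0`
finite-dimensional and irreducible over `𝔤`, over an algebraically closed field: there are an `I`-stable,
`I`-irreducible subspace `M'`, the space `N = M'' = Hom_I(M', M)` of linear maps `M' → M` commuting with `I` — on
which `J` acts by composition, irreducibly — and a linear isomorphism `e : M' ⊗ M'' ≅ M`, `e(m ⊗ n) = n(m)`
(so `I` acts through the first factor and `J` through the second), with `dim M = dim M' · dim M''`
(Bump Prop. 3.4.1 / 3.4.2 in the operator form `CommutingOperatorsSimpleModule.exists_tensor_of_irreducible`).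
Semisimplicity of `𝔤` is not needed for this step.
[cite: LooijengaLunts1997, §1 (1.2) Lemma and proof, p0004 L94–L105 (held TeX; proof continued in the PDF text p0007 L1)] [cite: Bump1997, Prop. 3.4.1, Prop. 3.4.2, PDF pp. 302–303] -/
theorem exists_tensor_of_isCompl_lieIdeal [IsAlgClosed K] [FiniteDimensional K M] [Nontrivial M]
    {𝔤 : LieSubalgebra K (Module.End K M)} {I J : LieIdeal K 𝔤} (hIJ : IsCompl I J)
    [LieModule.IsIrreducible K 𝔤 M] :
    ∃ (M' : Submodule K M) (N : Submodule K (M' →ₗ[K] M)) (e : M' ⊗[K] N ≃ₗ[K] M),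
      (∀ x ∈ I, M' ≤ M'.comap (x : Module.End K M)) ∧ M' ≠ ⊥ ∧
      (∀ W : Submodule K M, W ≤ M' → (∀ x ∈ I, W ≤ W.comap (x : Module.End K M)) → W = ⊥ ∨ W = M') ∧
      (∀ φ : M' →ₗ[K] M, φ ∈ N ↔
        ∀ x ∈ I, ∀ m m' : M', (m' : M) = (x : Module.End K M) m → φ m' = (x : Module.End K M) (φ m)) ∧
      (∀ (m : M') (φ : N), e (m ⊗ₜ[K] φ) = (φ : M' →ₗ[K] M) m) ∧
      (∀ y ∈ J, ∀ φ ∈ N, (y : Module.End K M) ∘ₗ φ ∈ N) ∧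
      (∀ N₀ : Submodule K (M' →ₗ[K] M), N₀ ≤ N → N₀ ≠ ⊥ →
        (∀ y ∈ J, ∀ φ ∈ N₀, (y : Module.End K M) ∘ₗ φ ∈ N₀) → N₀ = N) ∧
      finrank K M = finrank K M' * finrank K N := by
  -- the two commuting sets of operators
  set S : Set (Module.End K M) := (fun x : 𝔤 ↦ (x : Module.End K M)) '' (I : Set 𝔤) with hS
  set T : Set (Module.End K M) := (fun x : 𝔤 ↦ (x : Module.End K M)) '' (J : Set 𝔤) with hT
  have hSI : ∀ {P : Module.End K M → Prop}, (∀ x ∈ S, P x) ↔ ∀ x ∈ I, P (x : Module.End K M) := by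
    intro P; rw [hS, Set.forall_mem_image]; rfl
  have hTJ : ∀ {P : Module.End K M → Prop}, (∀ y ∈ T, P y) ↔ ∀ y ∈ J, P (y : Module.End K M) := by
    intro P; rw [hT, Set.forall_mem_image]; rfl
  have hST : ∀ x ∈ S, ∀ y ∈ T, Commute x y :=
    hSI.2 fun x hx ↦ hTJ.2 fun y hy ↦ commute_of_mem_lieIdeal_of_inf_eq_bot hIJ.inf_eq_bot hx hy
  have hirr : ∀ W : Submodule K M, (∀ x ∈ S ∪ T, W ≤ W.comap x) → W = ⊥ ∨ W = ⊤ := by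
    intro W hW
    refine (isIrreducible_iff_forall_stable_of_lieSubalgebra 𝔤).1 ‹_› W fun x hx v hv ↦ ?_
    have hI' : ∀ x ∈ I, ∀ v ∈ W, (x : Module.End K M) v ∈ W :=
      fun x hx v hv ↦ hW _ (Or.inl ⟨x, hx, rfl⟩) hv
    have hJ' : ∀ y ∈ J, ∀ v ∈ W, (y : Module.End K M) v ∈ W :=
      fun y hy v hv ↦ hW _ (Or.inr ⟨y, hy, rfl⟩) hv
    exact stable_of_stable_lieIdeal_of_sup_eq_top hIJ.sup_eq_top hI' hJ' ⟨x, hx⟩ hv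
  obtain ⟨M', N, e, h1, h2, h3, h4, h5, h6, h7, h8⟩ :=
    Literature.RepresentationTheory.Semisimple.CommutingOperators.exists_tensor_of_irreducible hST hirr
  refine ⟨M', N, e, hSI.1 h1, h2, fun W hW hWI ↦ h3 W hW (hSI.2 hWI), fun φ ↦ ?_, h5, hTJ.1 h6,
    fun N₀ hN₀ hN₀' hJ ↦ h7 N₀ hN₀ hN₀' (hTJ.2 hJ), h8⟩
  rw [h4]
  exact hSI

/-- **The (1.2) Lemma's tensor clause for a Lefschetz module**: `M ≠ 0` an irreducible Lefschetz `𝔞`-module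
(irreducible over `𝔤(𝔞, M)`, cf. `isIrreducible_iff_forall_stable`), `𝔤(𝔞, M) = 𝔤' × 𝔤''` a decomposition
into complementary ideals, `K` algebraically closed: `M ≅ M' ⊗ M''` with `M'` an irreducible `𝔤'`-module and
`M'' = Hom_{𝔤'}(M', M)` an irreducible `𝔤''`-module, as in `exists_tensor_of_isCompl_lieIdeal`.  (The graded
first clause of the Lemma is A1-112 `LefschetzTripleIdeals.lean`; the Lefschetz `𝔞`-module structures of the
factors and "`𝔤^{(i)} = 𝔤(𝔞, M^{(i)})`" are not formalised — see the file's SCOPE.)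
[cite: LooijengaLunts1997, §1 (1.2) Lemma and proof, p0004 L94–L105] -/
theorem exists_tensor_of_isCompl_lieIdeal_lefschetzLieAlgebra [IsAlgClosed K] [FiniteDimensional K M]
    [Nontrivial M] {h : Module.End K M} {𝔞 : Submodule K (Module.End K M)}
    {I J : LieIdeal K (lefschetzLieAlgebra K h 𝔞)} (hIJ : IsCompl I J)
    [LieModule.IsIrreducible K (lefschetzLieAlgebra K h 𝔞) M] :
    ∃ (M' : Submodule K M) (N : Submodule K (M' →ₗ[K] M)) (e : M' ⊗[K] N ≃ₗ[K] M),
      (∀ x ∈ I, M' ≤ M'.comap (x : Module.End K M)) ∧ M' ≠ ⊥ ∧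
      (∀ W : Submodule K M, W ≤ M' → (∀ x ∈ I, W ≤ W.comap (x : Module.End K M)) → W = ⊥ ∨ W = M') ∧
      (∀ φ : M' →ₗ[K] M, φ ∈ N ↔
        ∀ x ∈ I, ∀ m m' : M', (m' : M) = (x : Module.End K M) m → φ m' = (x : Module.End K M) (φ m)) ∧
      (∀ (m : M') (φ : N), e (m ⊗ₜ[K] φ) = (φ : M' →ₗ[K] M) m) ∧
      (∀ y ∈ J, ∀ φ ∈ N, (y : Module.End K M) ∘ₗ φ ∈ N) ∧
      (∀ N₀ : Submodule K (M' →ₗ[K] M), N₀ ≤ N → N₀ ≠ ⊥ →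
        (∀ y ∈ J, ∀ φ ∈ N₀, (y : Module.End K M) ∘ₗ φ ∈ N₀) → N₀ = N) ∧
      finrank K M = finrank K M' * finrank K N :=
  exists_tensor_of_isCompl_lieIdeal hIJ

end Literature.Algebra.Lie
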